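import Summits.QuantumFields.YangMills.Theorems.AlphaInputsT3ACv3Data
import Literature.MathematicalPhysics.QuantumFieldTheory.Balaban1983to89.T4StabilityFloor
import Literature.MathematicalPhysics.QuantumFieldTheory.Balaban1983to89.T4StabilityFloorUnitary
import Literature.MathematicalPhysics.QuantumFieldTheory.Balaban1983to89.HaarSmallBallClosedSubgroup
import Literature.MathematicalPhysics.QuantumFieldTheory.Balaban1983to89.B10Eq5RegularAction
import Literature.MathematicalPhysics.QuantumFieldTheory.Balaban1983to89.T3CruxEstimates
import Summits.QuantumFields.YangMills.Theorems.UnitScaleTiltHistoryTailChessboardT3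
import Summits.QuantumFields.YangMills.Theorems.UnitScaleTiltHistoryTailLowMassCore
import HarnessLib

/-!
# v3 TWIN (pen ★ym-ust-18916-p1 g4; OWNER RULING g18-№3 §4, REBASE-CHECKLIST v5p6 item 4) of `…Theorems.UnitScaleTiltHistoryTailLowMassCore` (ym3-torus-p2 g11) at
# ★alpha-1's v3 datum `AlphaInputsT3AC.OfV3At.dataT3v3` (`AlphaInputsT3ACv3Data`): the datum-dependent lemmas re-run VERBATIM with `OfV2At ↦ OfV3At`, `dataT3c ↦ dataT3v3`,
# `pkgAtV2 ↦ pkgAtV3`; the datum-free lemmas (`haar_real_ball_ge`, the counts, (11), `scheme_β_eq_pow_div`) are imported from the v2 file.  Text twin; nothing new claimed.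
# Route `UnitScaleTilt` — crux `HistoryTailL` (stmt-QuantumFields-19936), STUB 4b `stub_lowMass` — CORE (v3 datum):
# the trivial-history minimiser's action on a small ball (`β_K·A(U_j(triv,W)) = O(N_j³)` for `min(1,b₀)g_j`-small `W`) and the
# pointwise lower bound of the (47)-minorant of the concrete datum on the bond ball

Cell `ym3-torus` (HUMAN RULING D-0037, rung R3), seat `ym3-torus-p2` gen 11.  `--supports stmt-QuantumFields-19936`; consumed by the sibling
module `UnitScaleTiltHistoryTailLowMass` (the registered signature of `stub_lowMass`).

WHAT.  For ★alpha-1's version-3 datum at given [Balaban1985Variational] constants, `D = h.dataT3v3 hc γ hγ hγ1 π`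
(`AlphaInputsT3ACv3Data`), the (47)-minorant is `low_j(W) = χ_j(W)·exp(−mainT_j(triv, W) + Pint_j(triv, W))` with `χ_j` the indicator of
the route's window `PlaqSmall (θBal(K − j))`, `mainT_j(triv, W) = β_K·A(U_j(triv, W))` the Wilson action of the trivial-history minimiser in route
units and `Pint` the interaction sum.  Here: §1 the `SU(2)` small-ball volume, counts, (11); §2 `β_K·A(U_j(triv,W)) ≤ (2B₃²+2)·N_j³` for
`ε₁`-small `W`, `ε₁² ≤ g_j²`, `ε₁ ≤ a₁`; §3 `low_j(W) ≥ exp(−(2B₃²+2+CP)N_j³)` on the bond ball of radius `min(1,b₀)g_j/8`.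

HOW (no smooth-lift competitor is needed).  The minimiser row r1 of the lane's package (`MinimiserRowsT3`.1, projected
`PkgAtV3.uminTriv_mem_regFibrePr`) carries a FREE datum radius `ε₁`: for every `ε₁`-small datum `V`, `ε₁ ≤ a₁`, the trivial-history minimiser
lies in print's space (8) `regFibrePr F n K _ (B₃ε₁) V`, whose plaquette clause (`RegPr.plaqSmall`, `regThreshold`) puts EVERY fine plaquette of
`U_j(triv, W)` within `B₃ε₁·L^{−2(K−n)}` of `1` ([Balaban1985Variational] Thm 1 (8): `U ∈ 𝔘_k(B₃ε₁)`).  With (11) `1 − Re tr ≤ ½|·−1|²` and the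
plaquette count `3N_0³ = 3L^{3(K−n)}N³`: `β_K·A ≤ (3/2)B₃²(ε₁/g)²N³`.  At `j = 0` the minimiser is the datum itself (`PkgAt.hU0`) and `Pint_0 = 0`
(`noInteraction0_towerOfAC`); for `j ≥ 1` the window is charged (`dataT3v3_admOnSmall`) so `|Pint| ≤ CP·θBal(K−j+1)²N³ ≤ CP·N³` (`PintSize`).
-/

noncomputable section

namespace Summit.QuantumFields.YangMills.Theorems.HistoryTailLowMassV3

open MeasureTheory
open scoped Matrix.Norms.L2Operator
open Literature.MathematicalPhysics.QuantumFieldTheory (haarProbability)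
open Literature.MathematicalPhysics.QuantumFieldTheory.Balaban1983to89
open Literature.MathematicalPhysics.QuantumFieldTheory.Balaban1983to89.T3ContinuumYM3Torus
open Literature.MathematicalPhysics.QuantumFieldTheory.Balaban1983to89.T3UnitLawDensityEML (ℰp)
open Literature.MathematicalPhysics.QuantumFieldTheory.Balaban1983to89.T3UnitScaleTilt (θBal)
open Literature.MathematicalPhysics.QuantumFieldTheory.Balaban1983to89.T3LevelShift (fieldShift fieldShift_symm_fieldShift)
open Literature.MathematicalPhysics.QuantumFieldTheory.Balaban1983to89.T3PrintedRegularMinimiser (regFibrePr mem_regFibrePr_iff)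
open Literature.MathematicalPhysics.QuantumFieldTheory.Balaban1983to89.T3RegularMinimiser (regThreshold)
open Literature.MathematicalPhysics.QuantumFieldTheory.Balaban1983to89.T3AlphaInputsAC
open Literature.MathematicalPhysics.QuantumFieldTheory.Balaban1983to89.T4StabilityFloor (bondBall mem_bondBall
  fieldMeasure_real_bondBall measurableSet_bondBall card_pbond card_plaq)
open Summit.QuantumFields.Balaban3D.Carriers (suGroupModel Hist)
open Summit.QuantumFields.Balaban3D.Proofs.Primitives (AlphaConsts)
open Summit.QuantumFields.YangMills.Theorems.HistoryTailLowMass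
  (haar_real_ball_ge card_plaq_T3 card_pbond_T3 sitesPerDir_zero_eq_mul wilsonAction4_le_of_plaqSmall mul_coupling_le_θBal scheme_β_eq_pow_div)

/-! ## §1 Geometry and Haar volume: the `SU(2)` small ball, the bond ball, the plaquette and bond counts of the family -/

/-! ## §2 The main term on a small ball: the trivial-history minimiser is `B₃ε₁·L^{−2(K−n)}`-regular for `ε₁`-small data -/

section Datum

variable {F : T3Family} {𝔠 : AlphaConsts F.L (suGroupModel 2).N} {a₀ a₁ : ℝ}
  (h : AlphaInputsT3AC.OfV3At F 𝔠 a₀ a₁) (hc : 0 < a₀ ∧ 0 < a₁ ∧ 𝔠.B₃ * a₁ ≤ a₀)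
  (γ : ℝ) (hγ : 0 < γ) (hγ1 : γ ≤ (min 𝔠.gamma0 1) ^ 2) (π : AlphaInputsT3AC.PolymerT3 F)

/-- **THE MAIN TERM BELOW THE TOP, ON `ε₁`-SMALL DATA**: for `n < K` (at least one averaging step), `0 < ε₁ ≤ a₁` with `ε₁² ≤ g² = γL^{−n}`,
and every `ε₁`-small level-`(K − n)` field `W`, the Wilson action of the trivial-history minimiser in route units is at most
`2B₃²·N_{K−n}³`: the minimiser row r1 (`PkgAtV3.uminTriv_mem_regFibrePr`, [Balaban1985Variational] Thm 1 (8) at the FREE radius `ε₁`)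
puts it in print's space `𝔘_k(B₃ε₁)`, i.e. every fine plaquette within `B₃ε₁L^{−2(K−n)}` of `1`; then (11) and the plaquette count.
[cite: Balaban1985Variational, Thm 1 (8) p.279; Balaban1985UV3, (11) p.258] -/
theorem mainT_le_of_small_pos (K n : ℕ) (hnK : n < K) {ε₁ : ℝ} (hε₁ : 0 < ε₁) (ha₁ : ε₁ ≤ a₁)
    (hεg : ε₁ ^ 2 ≤ γ * ((F.L : ℝ)⁻¹) ^ n)
    (W : GaugeField (F.P K) (K - n) (Matrix.specialUnitaryGroup (Fin 2) ℂ)) (hW : PlaqSmall ε₁ W) :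
    (F.scheme ℰp γ).β K *
        wilsonAction4 ((h.dataT3v3 hc γ hγ hγ1 π).Umin K (K - n) ((h.dataT3v3 hc γ hγ hγ1 π).triv K (K - n)) W) ≤
      (2 * 𝔠.B₃ ^ 2 + 2) * ((F.P K).sitesPerDir (K - n) : ℝ) ^ 3 := by
  set p := h.pkgAtV3 hc γ hγ hγ1 K with hp
  have hs : (F.PP F.m K).sitesPerDir (K - n) = (F.PP F.m n).sitesPerDir 0 :=
    F.sitesPerDir_eq (m := F.m) (K := K) (j := K - n) (m' := F.m) (K' := n) (j' := 0) (by omega)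
  set V : GaugeField (F.P n) 0 (Matrix.specialUnitaryGroup (Fin 2) ℂ) := fieldShift hs.symm W with hV
  have hWV : fieldShift hs V = W := fieldShift_symm_fieldShift hs W
  have hVsmall : PlaqSmall ε₁ V := (T3CruxEstimates.plaqSmall_fieldShift F hs.symm ε₁ W).mpr hW
  have ha₁' : ε₁ ≤ p.a₁ := by rw [hp, h.pkgAtV3_a₁ hc γ hγ hγ1 K]; exact ha₁
  have hB₃ : 0 < 𝔠.B₃ := 𝔠.B₃_pos
  have hhi : 𝔠.B₃ * ε₁ ≤ p.a₀ := by
    rw [hp, h.pkgAtV3_a₀ hc γ hγ hγ1 K]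
    exact (mul_le_mul_of_nonneg_left ha₁ hB₃.le).trans hc.2.2
  have hmem := p.uminTriv_mem_regFibrePr hnK hε₁ ha₁' le_rfl hhi V hVsmall
  rw [hWV] at hmem
  have hps := ((mem_regFibrePr_iff (F := F)).mp hmem).2.plaqSmall
  -- the fine plaquettes of the minimiser are `B₃ε₁L^{−2(K−n)}`-small
  have hU : PlaqSmall (𝔠.B₃ * ε₁ * ((F.L : ℝ)⁻¹) ^ (2 * (K - n)))
      ((h.dataT3v3 hc γ hγ hγ1 π).Umin K (K - n) ((h.dataT3v3 hc γ hγ hγ1 π).triv K (K - n)) W) := hps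
  have hA := wilsonAction4_le_of_plaqSmall hU
  rw [card_plaq_T3, sitesPerDir_zero_eq_mul F hnK.le] at hA
  -- arithmetic
  have hL : (1 : ℝ) < F.L := by exact_mod_cast F.hL.2
  have hL0 : (0 : ℝ) < F.L := by linarith
  set ℓ : ℝ := (F.L : ℝ) with hℓ
  set a : ℝ := ℓ ^ (K - n) with ha
  set N : ℝ := ((F.P K).sitesPerDir (K - n) : ℝ) with hN
  have ha0 : 0 < a := pow_pos hL0 _
  have hN0 : 0 ≤ N := by positivity
  have hβ : (F.scheme ℰp γ).β K = ℓ ^ n * a / γ := by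
    rw [scheme_β_eq_pow_div, ha, ← pow_add]
    congr 2
    omega
  have hβ0 : 0 ≤ (F.scheme ℰp γ).β K := by rw [hβ]; positivity
  have hρ : (ℓ⁻¹) ^ (2 * (K - n)) = (a ^ 2)⁻¹ := by
    rw [ha, ← pow_mul, mul_comm, inv_pow]
  rw [hρ] at hA
  have hA' : wilsonAction4 ((h.dataT3v3 hc γ hγ hγ1 π).Umin K (K - n) ((h.dataT3v3 hc γ hγ hγ1 π).triv K (K - n)) W) ≤
      3 / 2 * 𝔠.B₃ ^ 2 * N ^ 3 * (ε₁ ^ 2 * a⁻¹) := by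
    refine hA.trans (le_of_eq ?_)
    field_simp
  have hg : ε₁ ^ 2 * ℓ ^ n / γ ≤ 1 := by
    have hℓn : 0 < ℓ ^ n := pow_pos hL0 n
    rw [div_le_one hγ]
    have : ε₁ ^ 2 ≤ γ * (ℓ ^ n)⁻¹ := by rw [← inv_pow]; exact hεg
    calc ε₁ ^ 2 * ℓ ^ n ≤ γ * (ℓ ^ n)⁻¹ * ℓ ^ n := mul_le_mul_of_nonneg_right this hℓn.le
      _ = γ := by field_simp
  calc (F.scheme ℰp γ).β K *
        wilsonAction4 ((h.dataT3v3 hc γ hγ hγ1 π).Umin K (K - n) ((h.dataT3v3 hc γ hγ hγ1 π).triv K (K - n)) W)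
      ≤ (ℓ ^ n * a / γ) * (3 / 2 * 𝔠.B₃ ^ 2 * N ^ 3 * (ε₁ ^ 2 * a⁻¹)) := by
        rw [← hβ]; exact mul_le_mul_of_nonneg_left hA' hβ0
    _ = 3 / 2 * 𝔠.B₃ ^ 2 * N ^ 3 * (ε₁ ^ 2 * ℓ ^ n / γ) := by field_simp
    _ ≤ 3 / 2 * 𝔠.B₃ ^ 2 * N ^ 3 * 1 := mul_le_mul_of_nonneg_left hg (by positivity)
    _ ≤ (2 * 𝔠.B₃ ^ 2 + 2) * N ^ 3 := by nlinarith [sq_nonneg 𝔠.B₃, pow_nonneg hN0 3]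

/-- **THE MAIN TERM AT THE FINEST LEVEL `j = 0`** (no averaging: `U_0(triv, W) = W`, `PkgAt.hU0`): for `ε₁² ≤ g_0² = γL^{−K}` and an
`ε₁`-small `W`, `β_K·A(W) ≤ (3/2)·N_0³ ≤ (2B₃² + 2)·N_0³`. [cite: Balaban1985UV3, (11) p.258 and (42) p.266] -/
theorem mainT_le_of_small_zero (K : ℕ) {ε₁ : ℝ} (hεg : ε₁ ^ 2 ≤ γ * ((F.L : ℝ)⁻¹) ^ (K - 0))
    (W : GaugeField (F.P K) 0 (Matrix.specialUnitaryGroup (Fin 2) ℂ)) (hW : PlaqSmall ε₁ W) :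
    (F.scheme ℰp γ).β K *
        wilsonAction4 ((h.dataT3v3 hc γ hγ hγ1 π).Umin K 0 ((h.dataT3v3 hc γ hγ hγ1 π).triv K 0) W) ≤
      (2 * 𝔠.B₃ ^ 2 + 2) * ((F.P K).sitesPerDir 0 : ℝ) ^ 3 := by
  have hU : (h.dataT3v3 hc γ hγ hγ1 π).Umin K 0 ((h.dataT3v3 hc γ hγ hγ1 π).triv K 0) W = W :=
    (h.pkgAtV3 hc γ hγ hγ1 K).hU0 W
  rw [hU]
  have hA := wilsonAction4_le_of_plaqSmall hW
  rw [card_plaq_T3] at hA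
  have hL : (1 : ℝ) < F.L := by exact_mod_cast F.hL.2
  have hL0 : (0 : ℝ) < F.L := by linarith
  set ℓ : ℝ := (F.L : ℝ) with hℓ
  set N : ℝ := ((F.P K).sitesPerDir 0 : ℝ) with hN
  have hN0 : 0 ≤ N := by positivity
  rw [Nat.sub_zero] at hεg
  have hβ : (F.scheme ℰp γ).β K = ℓ ^ K / γ := scheme_β_eq_pow_div γ K
  have hβ0 : 0 ≤ (F.scheme ℰp γ).β K := by rw [hβ]; positivity
  have hg : ε₁ ^ 2 * ℓ ^ K / γ ≤ 1 := by
    have hℓn : 0 < ℓ ^ K := pow_pos hL0 K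
    rw [div_le_one hγ]
    have : ε₁ ^ 2 ≤ γ * (ℓ ^ K)⁻¹ := by rw [← inv_pow]; exact hεg
    calc ε₁ ^ 2 * ℓ ^ K ≤ γ * (ℓ ^ K)⁻¹ * ℓ ^ K := mul_le_mul_of_nonneg_right this hℓn.le
      _ = γ := by field_simp
  calc (F.scheme ℰp γ).β K * wilsonAction4 W
      ≤ (ℓ ^ K / γ) * (3 * N ^ 3 * (ε₁ ^ 2 / 2)) := by rw [← hβ]; exact mul_le_mul_of_nonneg_left hA hβ0
    _ = 3 / 2 * N ^ 3 * (ε₁ ^ 2 * ℓ ^ K / γ) := by ring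
    _ ≤ 3 / 2 * N ^ 3 * 1 := mul_le_mul_of_nonneg_left hg (by positivity)
    _ ≤ (2 * 𝔠.B₃ ^ 2 + 2) * N ^ 3 := by nlinarith [sq_nonneg 𝔠.B₃, pow_nonneg hN0 3]

/-- **NO INTERACTION AT `j = 0`**: `Pint_0(triv, W) = 0` for the concrete datum (the series' `Pint 0 = 0`, `noInteraction0_towerOfAC`).
[cite: Balaban1985UV3, (1) p.256 and (43) p.266] -/
theorem pint_zero (K : ℕ) (W : GaugeField (F.P K) 0 (Matrix.specialUnitaryGroup (Fin 2) ℂ)) :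
    (h.dataT3v3 hc γ hγ hγ1 π).Pint K 0 ((h.dataT3v3 hc γ hγ hγ1 π).triv K 0) W = 0 :=
  Summit.QuantumFields.Balaban3D.Proofs.InputsAC.noInteraction0_towerOfAC 𝔠.lane (h.pkgAtV3 hc γ hγ hγ1 K).X
    (h.pkgAtV3 hc γ hγ hγ1 K).𝔖 (Hist.triv (F.P K) 0) W

end Datum


/-! ## §3 The (47)-minorant on the bond ball -/

section Assembly

variable {F : T3Family} {𝔠 : AlphaConsts F.L (suGroupModel 2).N} {a₀ a₁ : ℝ}
  (h : AlphaInputsT3AC.OfV3At F 𝔠 a₀ a₁) (hc : 0 < a₀ ∧ 0 < a₁ ∧ 𝔠.B₃ * a₁ ≤ a₀)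
  (γ : ℝ) (hγ : 0 < γ) (hγ1 : γ ≤ (min 𝔠.gamma0 1) ^ 2) (π : AlphaInputsT3AC.PolymerT3 F)

/-- **THE (47)-MINORANT ON THE BOND BALL OF RADIUS `min(1,b₀)·g_j/8`**: the ball lies inside the route's window (`θBal ≥ b₀g_j`), so
`χ_j = 1` (`dataT3v3_chi_eq`), the pair `(triv, W)` is charged (`dataT3v3_admOnSmall`) and `|Pint| ≤ CP·θBal(K−j+1)²N³ ≤ CP·N³`
(`PintSize`; `Pint_0 = 0` at `j = 0`); with the main-term bound `β_K·A(U_j(triv,W)) ≤ (2B₃²+2)N³` this gives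
`low_j(W) ≥ exp(−(2B₃² + 2 + CP)·N_j³)`. [cite: Balaban1985UV3, (47) p.267 and (44)-(46) p.267] -/
theorem low_ge_on_ball {CP : ℝ} (hCP : 0 ≤ CP) (hPS : PintSize (h.dataT3v3 hc γ hγ hγ1 π) 𝔠.b₀ 𝔠.p₀ CP)
    (hθ1 : ∀ i, θBal F.L γ 𝔠.b₀ 𝔠.p₀ i ≤ 1) (hγ1' : γ ≤ 1) (K k : ℕ) (hk : k ≤ K)
    (hmain : ∀ W : GaugeField (F.P K) k (Matrix.specialUnitaryGroup (Fin 2) ℂ),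
      PlaqSmall (min 1 𝔠.b₀ * Real.sqrt (γ * ((F.L : ℝ)⁻¹) ^ (K - k))) W →
        (F.scheme ℰp γ).β K *
            wilsonAction4 ((h.dataT3v3 hc γ hγ hγ1 π).Umin K k ((h.dataT3v3 hc γ hγ hγ1 π).triv K k) W) ≤
          (2 * 𝔠.B₃ ^ 2 + 2) * ((F.P K).sitesPerDir k : ℝ) ^ 3)
    (W : GaugeField (F.P K) k (Matrix.specialUnitaryGroup (Fin 2) ℂ))
    (hWb : ∀ b, dist1 (W b) ≤ min 1 𝔠.b₀ * Real.sqrt (γ * ((F.L : ℝ)⁻¹) ^ (K - k)) / 8) :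
    Real.exp (-((2 * 𝔠.B₃ ^ 2 + 2 + CP) * ((F.P K).sitesPerDir k : ℝ) ^ 3)) ≤
      (h.dataT3v3 hc γ hγ hγ1 π).low K k W := by
  set g : ℝ := Real.sqrt (γ * ((F.L : ℝ)⁻¹) ^ (K - k)) with hg
  set t : ℝ := min 1 𝔠.b₀ with ht
  set N : ℝ := ((F.P K).sitesPerDir k : ℝ) with hN
  have hL1 : 1 ≤ F.L := F.hL.2.le
  have hg0 : 0 < g := (T3ThresholdSmallness.sqrt_coupling_pos_le hL1 hγ (K - k)).1
  have hg1 : g ≤ 1 := T3Thresholds.coupling_le_one hL1 hγ hγ1' (K - k)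
  have ht0 : 0 < t := lt_min one_pos 𝔠.b₀_pos
  have htb : t ≤ 𝔠.b₀ := min_le_right _ _
  have hε0 : 0 < t * g := mul_pos ht0 hg0
  have hN0 : 0 ≤ N := by positivity
  -- the window contains the ball
  have hθ : t * g ≤ θBal F.L γ 𝔠.b₀ 𝔠.p₀ (K - k) :=
    (mul_le_mul_of_nonneg_right htb hg0.le).trans (mul_coupling_le_θBal 𝔠.b₀_pos.le 𝔠.p₀_pos.le (K - k) hg0 hg1)
  have hWε : PlaqSmall (t * g) W := T4StabilityFloorUnitary.plaqSmall_of_bond_le hWb (by linarith)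
  have hWθ : PlaqSmall (θBal F.L γ 𝔠.b₀ 𝔠.p₀ (K - k)) W := T4StabilityFloorUnitary.plaqSmall_of_bond_le hWb (by linarith)
  -- `χ = 1` on the window
  have hχ : (h.dataT3v3 hc γ hγ hγ1 π).χ K k W = 1 := by
    rw [h.dataT3v3_chi_eq hc γ hγ hγ1 π K k hk W]
    unfold chiSmall
    rw [if_pos (show PlaqSmallOn Set.univ (θBal F.L γ 𝔠.b₀ 𝔠.p₀ (K - k)) W from fun q _ => hWθ q)]
  -- the main term
  have hmainT : (h.dataT3v3 hc γ hγ hγ1 π).mainT K k ((h.dataT3v3 hc γ hγ hγ1 π).triv K k) W ≤ (2 * 𝔠.B₃ ^ 2 + 2) * N ^ 3 := by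
    rw [h.dataT3v3_mainTermIsAction hc γ hγ hγ1 π K k ((h.dataT3v3 hc γ hγ hγ1 π).triv K k) W]
    exact hmain W hWε
  -- the interaction
  have hPint : -(CP * N ^ 3) ≤ (h.dataT3v3 hc γ hγ hγ1 π).Pint K k ((h.dataT3v3 hc γ hγ hγ1 π).triv K k) W := by
    rcases Nat.eq_zero_or_pos k with hk0 | hkpos
    · subst hk0
      rw [pint_zero h hc γ hγ hγ1 π K W]
      have : 0 ≤ CP * N ^ 3 := by positivity
      linarith
    · have hadm := h.dataT3v3_admOnSmall hc γ hγ hγ1 π K k W hk hWθ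
      have hsize := hPS K k ((h.dataT3v3 hc γ hγ hγ1 π).triv K k) W hk hkpos hadm
      have hθ0 : 0 ≤ θBal F.L γ 𝔠.b₀ 𝔠.p₀ (K - k + 1) :=
        (T3MinimiserStabilityReduction.θBal_pos hL1 hγ hγ1' 𝔠.b₀_pos 𝔠.p₀ (K - k + 1)).le
      have hθsq : θBal F.L γ 𝔠.b₀ 𝔠.p₀ (K - k + 1) ^ 2 ≤ 1 := pow_le_one₀ hθ0 (hθ1 _)
      have hb : CP * θBal F.L γ 𝔠.b₀ 𝔠.p₀ (K - k + 1) ^ 2 * N ^ 3 ≤ CP * N ^ 3 := by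
        have h1 : CP * θBal F.L γ 𝔠.b₀ 𝔠.p₀ (K - k + 1) ^ 2 ≤ CP * 1 := mul_le_mul_of_nonneg_left hθsq hCP
        have := mul_le_mul_of_nonneg_right h1 (pow_nonneg hN0 3)
        linarith
      have hlow := (abs_le.mp hsize).1
      linarith
  -- assemble
  show _ ≤ AlphaDataT3.low (h.dataT3v3 hc γ hγ hγ1 π) K k W
  unfold AlphaDataT3.low
  rw [hχ, one_mul]
  exact Real.exp_le_exp.mpr (by linarith)

end Assembly

end Summit.QuantumFields.YangMills.Theorems.HistoryTailLowMassV3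

end
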